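import Literature.MathematicalPhysics.QuantumLattice.HubbardTTPrimeWindowCertificateThermal
import HarnessLib

/-!
# Thermal soundness of `T = 0` window certificates WITH ANCHOR CUTS (the production shape): the cut rows hold in every thermal torus
# limit by the variational inequality, so the thermal re-pricing is again `κ·2H_b(n/2)/β` and nothing else

Family `hubbard` (topic `MathematicalPhysics/QuantumLattice`); seat `hubbard-downfold-unc-2` (`prover-hubbard-downfold-unc-2-g18-0`). Sequel of
`HubbardTTPrimeWindowCertificateThermal` (cut-free identity). The certificates of record carry, besides the energy CAP row `κ(u − ΓE_Φ)`, a list of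
FLOOR / anchor-CUT rows `λ_A(ΓE_{Φ(t,t'_A,U_A)} − ℓ_A)` with `ℓ_A ≤ e(t,t'_A,U_A,n)` certified (`HubbardTTPrimeWindowCertificateCrossCuts`, the
`_crossCuts` soundness theorem for ground states; the own floor is the case `(t'_A, U_A) = (t', U)`). In a torus limit of the canonical sector
Gibbs states at `(β; t, t', U, n)` every cut row is still non-negative — `e_{Φ_A}(ω) ≥ e(t,t'_A,U_A,n) ≥ ℓ_A` for EVERY translation-invariant state of
density `n` (`IsTorusLimitOfMixture.energyDensityTT'_le_meanEnergy_of_sectorGibbs`) — so the thermal reading loses exactly the cap re-pricing: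

  `c − κ·2H_b(n/2)/β − Σ‖a_k‖ + (Σ_σ μ_σ)(n/2 − ν) ≤ Re ω_{Λ'}(Xw)`   (and the `D₄`-orbit form).

Proof: fold the cuts into the objective (`X' = Xw − Σ_A λ_A(ΓE_A − ℓ_A·1)`), apply the cut-free thermal theorem, unfold
`Re ω_{Λ'}(ΓE_A) = e_{Φ_A}(ω)` (definition of the mean energy + compatibility) and drop the non-negative cut slack.
Everything is PROVED; no definition, no number. HONEST SCOPE as in the companion: a warrant for THERMAL claim nodes from the SAME bytes; the
ground-state `Prop` of a node does not imply its thermal twin.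

## References
* J. Wang et al., PRX 14 (2024) 031006, §III. [cite: WangEtAl2024, §III]
* D. Ruelle, *Statistical Mechanics* (1969), §2.5, §3.4. [cite: Ruelle1969, §3.4]
-/

noncomputable section

namespace Literature.MathematicalPhysics.QuantumLattice

open Matrix Finset HubbardWave0 Literature.Probability.LatticeModels ThermodynamicLimit
open Literature.MathematicalPhysics.QuantumManyBody.StateRelaxation
open _root_.Filter
open scoped _root_.Topology ComplexOrder BigOperators Matrix.Norms.L2Operator

namespace InfVolFermionState

variable {t t' U n β : ℝ}

/-- Reading a folded objective in a state: `Re ω_{Λ'}(X − Σₖ λₖ•(Eₖ − ℓₖ•1)) = Re ω_{Λ'}(X) − Σₖ λₖ (Re ω_{Λ'}(Eₖ) − ℓₖ)`. [folklore] -/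
private theorem re_expect_sub_sum_smul_thermal (ω : InfVolFermionState 2) {Λ' : Finset (Site 2)} (Xw : FermionOp Λ')
    {α : Type*} (A : Finset α) (lam lo : α → ℝ) (E : α → FermionOp Λ') :
    (ω.expect Λ' (Xw - ∑ k ∈ A, ((lam k : ℝ) : ℂ) • (E k - ((lo k : ℝ) : ℂ) • (1 : FermionOp Λ')))).re =
      (ω.expect Λ' Xw).re - ∑ k ∈ A, lam k * ((ω.expect Λ' (E k)).re - lo k) := by
  simp only [map_sub, map_sum, map_smul, ω.expect_one, smul_eq_mul, mul_one, Complex.sub_re,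
    Complex.re_sum, Complex.re_ofReal_mul, Complex.ofReal_re]

/-- **`T = 0` WINDOW CERTIFICATE WITH ANCHOR CUTS, read in a thermal torus limit at its own point.** Data as in
`IsTorusLimitOf.re_sum_expect_d4_ge_of_window_certificate_TT'_ineq_crossCuts` (cap `(κ ≥ 0, u)` with `e(t,t',U,n) ≤ u`; cuts `(t'_A, U_A ≥ 0, ℓ_A, λ_A ≥ 0)` with
`ℓ_A ≤ e(t,t'_A,U_A,n)`; any point-group labels on the defects; charged words charged); `U ≥ 0`, `0 ≤ n < 2`, `β > 0`. Then for every torus limit `ω`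
of the canonical `(rectN n L, S^z = 0)`-sector Gibbs states of `hubbardTorusTT' L t t' U` at `β`:
`c − κ·2H_b(n/2)/β − Σ‖a_k‖ + (Σ_σ μ_σ)(n/2 − ν) ≤ Re ω_{Λ'}(Xw)`. [cite: WangEtAl2024, §III] [cite: Ruelle1969, §3.4] -/
theorem IsTorusLimitOfMixture.re_expect_ge_of_window_certificate_TT'_ineq_crossCuts_of_sectorGibbs_thermal
    (hU : 0 ≤ U) (hn0 : 0 ≤ n) (hn2 : n < 2) (hβ : 0 < β) {κ u : ℝ} (hκ : 0 ≤ κ)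
    (hu : energyDensityTT' t t' U n ≤ u)
    {α : Type*} (A : Finset α) (tpc Uc lo lam : α → ℝ) (hUc : ∀ k ∈ A, 0 ≤ Uc k)
    (hlo : ∀ k ∈ A, lo k ≤ energyDensityTT' t (tpc k) (Uc k) n) (hlam : ∀ k ∈ A, 0 ≤ lam k)
    {Λ Λ' : Finset (Site 2)} (hΛ : Λ ⊆ Λ') (h8 : thicken Λ 1 ⊆ Λ')
    (h0 : thicken ({0} : Finset (Site 2)) 1 ⊆ Λ') (hz : (0 : Site 2) ∈ Λ')
    (Xw : FermionOp Λ') (μ : Fin 2 → ℝ) (ν : ℝ)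
    {m : Type*} [Fintype m] [DecidableEq m] {Λm : Matrix m m ℂ} (hΛm : Λm.PosSemidef)
    (O : m → FermionOp Λ')
    {κ' : Type*} (s : Finset κ') (B : κ' → FermionOp Λ)
    {ι : Type*} (tt : Finset ι) (γ : ι → DihedralGroup 4) (wv : ι → Site 2)
    (hsh : ∀ l, d4ShiftSet (γ l) (wv l) Λ ⊆ Λ') (Y : ι → FermionOp Λ)
    {ρ : Type*} (uu : Finset ρ) (b : ρ → ℂ) (cw : ρ → List (Orb (PolySite Λ') × Bool))
    (hcw : ∀ j ∈ uu, ladderCharge (cw j) ≠ 0 ∨ ladderSpinCharge (cw j) ≠ 0)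
    {δ : Type*} (ah : Finset δ) (dc : δ → ℝ) (V : δ → FermionOp Λ')
    {κ'' : Type*} (w : Finset κ'') (a : κ'' → ℂ) (word : κ'' → List (Orb (PolySite Λ') × Bool)) {c : ℝ}
    (hcert : Xw - (c : ℂ) • (1 : FermionOp Λ') -
        ∑ σ : Fin 2, ((μ σ : ℝ) : ℂ) • (nAt 0 hz σ - ((ν : ℝ) : ℂ) • (1 : FermionOp Λ')) -
        ((κ : ℝ) : ℂ) • (((u : ℝ) : ℂ) • (1 : FermionOp Λ') -
          fermionEmbed (PolySite.incl h0) ((hubbardTTPrimeFermionInteraction t t' U).meanEnergyObs 1)) -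
        ∑ k ∈ A, ((lam k : ℝ) : ℂ) •
          (fermionEmbed (PolySite.incl h0)
              ((hubbardTTPrimeFermionInteraction t (tpc k) (Uc k)).meanEnergyObs 1) -
            ((lo k : ℝ) : ℂ) • (1 : FermionOp Λ')) =
      gramForm Λm O +
        (∑ k ∈ s, ((hubbardTTPrimeFermionInteraction t t' U).localHamiltonian Λ' * fermionEmbed (PolySite.incl hΛ) (B k) -
            fermionEmbed (PolySite.incl hΛ) (B k) * (hubbardTTPrimeFermionInteraction t t' U).localHamiltonian Λ') +
          ∑ l ∈ tt, (fermionEmbed (PolySite.incl (hsh l)) (fermionEmbed (PolySite.d4Emb (γ l) (wv l) Λ) (Y l)) -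
            fermionEmbed (PolySite.incl hΛ) (Y l)) +
          ∑ j ∈ uu, b j • ladderWord (cw j)) +
        (∑ m' ∈ ah, ((dc m' : ℝ) : ℂ) • ((V m')ᴴ - V m') + ∑ k ∈ w, a k • ladderWord (word k)))
    {ω : InfVolFermionState 2} {Ls : ℕ → ℕ}
    (hω : ω.IsTorusLimitOfMixture (sectorGibbsCount n) (fun L => sectorGibbsWeightTT' β t t' U n L)
      (fun L => sectorGibbsVectorTT' t t' U n L) Ls)
    (hLs : Tendsto Ls atTop atTop) :
    c - κ * (2 * Real.binEntropy (n / 2) / β) - ∑ k ∈ w, ‖a k‖ + (∑ σ : Fin 2, μ σ) * (n / 2 - ν) ≤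
      (ω.expect Λ' Xw).re := by
  -- the folded objective
  set X' : FermionOp Λ' := Xw - ∑ k ∈ A, ((lam k : ℝ) : ℂ) •
    (fermionEmbed (PolySite.incl h0) ((hubbardTTPrimeFermionInteraction t (tpc k) (Uc k)).meanEnergyObs 1) -
      ((lo k : ℝ) : ℂ) • (1 : FermionOp Λ')) with hX'
  have hcert' : X' - (c : ℂ) • (1 : FermionOp Λ') -
      ∑ σ : Fin 2, ((μ σ : ℝ) : ℂ) • (nAt 0 hz σ - ((ν : ℝ) : ℂ) • (1 : FermionOp Λ')) -
      ((κ : ℝ) : ℂ) • (((u : ℝ) : ℂ) • (1 : FermionOp Λ') -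
        fermionEmbed (PolySite.incl h0) ((hubbardTTPrimeFermionInteraction t t' U).meanEnergyObs 1)) =
      gramForm Λm O +
        (∑ k ∈ s, ((hubbardTTPrimeFermionInteraction t t' U).localHamiltonian Λ' * fermionEmbed (PolySite.incl hΛ) (B k) -
            fermionEmbed (PolySite.incl hΛ) (B k) * (hubbardTTPrimeFermionInteraction t t' U).localHamiltonian Λ') +
          ∑ l ∈ tt, (fermionEmbed (PolySite.incl (hsh l)) (fermionEmbed (PolySite.d4Emb (γ l) (wv l) Λ) (Y l)) -
            fermionEmbed (PolySite.incl hΛ) (Y l)) +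
          ∑ j ∈ uu, b j • ladderWord (cw j)) +
        (∑ m' ∈ ah, ((dc m' : ℝ) : ℂ) • ((V m')ᴴ - V m') + ∑ k ∈ w, a k • ladderWord (word k)) := by
    rw [← hcert, hX']
    abel
  have h := IsTorusLimitOfMixture.re_expect_ge_of_window_certificate_TT'_ineq_of_sectorGibbs_thermal hU hn0 hn2 hβ hκ hu hΛ h8 h0
    hz X' μ ν hΛm O s B tt γ wv hsh Y uu b cw hcw ah dc V w a word hcert' hω hLs
  -- the cut slack is non-negative in the thermal state
  have hE : ∀ k ∈ A, (ω.expect Λ' (fermionEmbed (PolySite.incl h0)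
      ((hubbardTTPrimeFermionInteraction t (tpc k) (Uc k)).meanEnergyObs 1))).re =
      ω.meanEnergy (hubbardTTPrimeFermionInteraction t (tpc k) (Uc k)) 1 := by
    intro k _
    rw [ω.compatible h0]
    rfl
  have hcut : ∀ k ∈ A, lo k ≤ ω.meanEnergy (hubbardTTPrimeFermionInteraction t (tpc k) (Uc k)) 1 :=
    fun k hk => (hlo k hk).trans (hω.energyDensityTT'_le_meanEnergy_of_sectorGibbs t t' U hn0 hn2 β hLs (tpc k) (hUc k hk))
  have hnn : 0 ≤ ∑ k ∈ A, lam k * ((ω.expect Λ' (fermionEmbed (PolySite.incl h0)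
      ((hubbardTTPrimeFermionInteraction t (tpc k) (Uc k)).meanEnergyObs 1))).re - lo k) :=
    Finset.sum_nonneg fun k hk => mul_nonneg (hlam k hk) (by rw [hE k hk]; linarith [hcut k hk])
  rw [hX', re_expect_sub_sum_smul_thermal] at h
  linarith

/-- **`D₄`-orbit form with cuts** (nonempty label set `S`; thermal torus limits are exactly `D₄`-invariant). [cite: WangEtAl2024, §III] -/
theorem IsTorusLimitOfMixture.re_sum_expect_d4_ge_of_window_certificate_TT'_ineq_crossCuts_of_sectorGibbs_thermal
    (hU : 0 ≤ U) (hn0 : 0 ≤ n) (hn2 : n < 2) (hβ : 0 < β) {κ u : ℝ} (hκ : 0 ≤ κ)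
    (hu : energyDensityTT' t t' U n ≤ u)
    {α : Type*} (A : Finset α) (tpc Uc lo lam : α → ℝ) (hUc : ∀ k ∈ A, 0 ≤ Uc k)
    (hlo : ∀ k ∈ A, lo k ≤ energyDensityTT' t (tpc k) (Uc k) n) (hlam : ∀ k ∈ A, 0 ≤ lam k)
    {Λ Λ' : Finset (Site 2)} (hΛ : Λ ⊆ Λ') (h8 : thicken Λ 1 ⊆ Λ')
    (h0 : thicken ({0} : Finset (Site 2)) 1 ⊆ Λ') (hz : (0 : Site 2) ∈ Λ')
    {S : Finset (DihedralGroup 4)} (hS : S.Nonempty)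
    (Xw : FermionOp Λ') (μ : Fin 2 → ℝ) (ν : ℝ)
    {m : Type*} [Fintype m] [DecidableEq m] {Λm : Matrix m m ℂ} (hΛm : Λm.PosSemidef)
    (O : m → FermionOp Λ')
    {κ' : Type*} (s : Finset κ') (B : κ' → FermionOp Λ)
    {ι : Type*} (tt : Finset ι) (γ : ι → DihedralGroup 4) (wv : ι → Site 2)
    (hsh : ∀ l, d4ShiftSet (γ l) (wv l) Λ ⊆ Λ') (Y : ι → FermionOp Λ)
    {ρ : Type*} (uu : Finset ρ) (b : ρ → ℂ) (cw : ρ → List (Orb (PolySite Λ') × Bool))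
    (hcw : ∀ j ∈ uu, ladderCharge (cw j) ≠ 0 ∨ ladderSpinCharge (cw j) ≠ 0)
    {δ : Type*} (ah : Finset δ) (dc : δ → ℝ) (V : δ → FermionOp Λ')
    {κ'' : Type*} (w : Finset κ'') (a : κ'' → ℂ) (word : κ'' → List (Orb (PolySite Λ') × Bool)) {c : ℝ}
    (hcert : Xw - (c : ℂ) • (1 : FermionOp Λ') -
        ∑ σ : Fin 2, ((μ σ : ℝ) : ℂ) • (nAt 0 hz σ - ((ν : ℝ) : ℂ) • (1 : FermionOp Λ')) -
        ((κ : ℝ) : ℂ) • (((u : ℝ) : ℂ) • (1 : FermionOp Λ') -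
          fermionEmbed (PolySite.incl h0) ((hubbardTTPrimeFermionInteraction t t' U).meanEnergyObs 1)) -
        ∑ k ∈ A, ((lam k : ℝ) : ℂ) •
          (fermionEmbed (PolySite.incl h0)
              ((hubbardTTPrimeFermionInteraction t (tpc k) (Uc k)).meanEnergyObs 1) -
            ((lo k : ℝ) : ℂ) • (1 : FermionOp Λ')) =
      gramForm Λm O +
        (∑ k ∈ s, ((hubbardTTPrimeFermionInteraction t t' U).localHamiltonian Λ' * fermionEmbed (PolySite.incl hΛ) (B k) -
            fermionEmbed (PolySite.incl hΛ) (B k) * (hubbardTTPrimeFermionInteraction t t' U).localHamiltonian Λ') +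
          ∑ l ∈ tt, (fermionEmbed (PolySite.incl (hsh l)) (fermionEmbed (PolySite.d4Emb (γ l) (wv l) Λ) (Y l)) -
            fermionEmbed (PolySite.incl hΛ) (Y l)) +
          ∑ j ∈ uu, b j • ladderWord (cw j)) +
        (∑ m' ∈ ah, ((dc m' : ℝ) : ℂ) • ((V m')ᴴ - V m') + ∑ k ∈ w, a k • ladderWord (word k)))
    {ω : InfVolFermionState 2} {Ls : ℕ → ℕ}
    (hω : ω.IsTorusLimitOfMixture (sectorGibbsCount n) (fun L => sectorGibbsWeightTT' β t t' U n L)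
      (fun L => sectorGibbsVectorTT' t t' U n L) Ls)
    (hLs : Tendsto Ls atTop atTop) :
    c - κ * (2 * Real.binEntropy (n / 2) / β) - ∑ k ∈ w, ‖a k‖ + (∑ σ : Fin 2, μ σ) * (n / 2 - ν) ≤
      (S.card : ℝ)⁻¹ * ∑ g ∈ S, (ω.expect (d4ShiftSet g 0 Λ') (fermionEmbed (PolySite.d4Emb g 0 Λ') Xw)).re := by
  have hD := hω.isD4Invariant_of_sectorGibbs t t' U n β hLs
  have hconst : ∑ g ∈ S, (ω.expect (d4ShiftSet g 0 Λ') (fermionEmbed (PolySite.d4Emb g 0 Λ') Xw)).re =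
      (S.card : ℝ) * (ω.expect Λ' Xw).re := by
    rw [Finset.sum_congr rfl fun g _ => by rw [hD.expect_fermionEmbed_d4Emb g Λ' Xw], Finset.sum_const, nsmul_eq_mul]
  have hcard : (0 : ℝ) < S.card := Nat.cast_pos.2 (Finset.card_pos.2 hS)
  rw [hconst, ← mul_assoc, inv_mul_cancel₀ hcard.ne', one_mul]
  exact IsTorusLimitOfMixture.re_expect_ge_of_window_certificate_TT'_ineq_crossCuts_of_sectorGibbs_thermal hU hn0 hn2 hβ hκ hu A
    tpc Uc lo lam hUc hlo hlam hΛ h8 h0 hz Xw μ ν hΛm O s B tt γ wv hsh Y uu b cw hcw ah dc V w a word hcert hω hLs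

end InfVolFermionState

end Literature.MathematicalPhysics.QuantumLattice

end
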